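import Mathlib
import HarnessLib
import Summits.Ventures.LatticeQCDFlow.Exactness.FlowPushforward
import Summits.Ventures.LatticeQCDFlow.Exactness.TorusCircleChart
import Summits.Ventures.LatticeQCDFlow.Exactness.SU2TorusAlcoveJacobian
import Summits.Ventures.LatticeQCDFlow.Exactness.JacobianRestrictDensity

/-!
# The general stick-breaking chart, every `N`: the open box `(0,1)ⁿ` is carried onto the open simplex with Jacobian `∏_i ∏_{j<i} (1 − a_j)`, so box flows become simplex flows with the booked correction

HONEST FRAMING: exact (Metropolis-corrected) sampling algorithms for lattice gauge theory;
figures of merit are autocorrelation/cost numbers at stated couplings and volumes; no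
continuum-physics claim.

Venture `LatticeQCDFlow` (cell pub-lqcd), topic `Exactness`; FANOUT row 10 (`eng-equiv`, engine
`latflow.equiv` `spectral.phi` / `phi_inv` for general `N`: `ρ_i = a_i ∏_{j<i}(1 − a_j)`,
`ld_phi = Σ_i Σ_{j<i} log(1 − a_j)`; Boyda et al., PRD 103 (2021) 074504 eqs. (22)–(24)).  NEW WORK of
the cell: the every-`N` version of `StickBreakingFinTwo.lean`, over Mathlib's change-of-variables theorem
(`map_withDensity_abs_det_fderiv_eq_addHaar`, triangular derivative via `Matrix.det_of_lowerTriangular`)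
and this row's `hasJacobian_of_presentation_ae` / `HasJacobian.withDensity_of_pos_ae`.  Nothing is cited
as a fact; no number; no definition (the chart enters through the characterising hypothesis `hφ`).  With
`AlcoveGapChartSUN.lean` (simplex → alcove) and `SUNTorusAlcoveJacobian.lean` (alcove → torus) this closes
the every-`N` box → torus pipeline of the spectral kernel.

## What is typed (`B = (0,1)ⁿ`, `Δ° = {ρ_k > 0, Σρ < 1}`, `φ(a)_i = a_i ∏_{j<i} (1 − a_j)`,
`D(a) = ∏_i ∏_{j<i} (1 − a_j)`)

* `hasFDerivAt_stickBreaking_sun`, `det_stickBreakingDeriv_sun` (`det dφ(a) = D(a)`: the derivative is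
  lower triangular with diagonal `∏_{j<i}(1 − a_j)`), `sum_prefix_stickBreaking` (`Σ_{j<i} φ(a)_j =
  1 − ∏_{j<i}(1 − a_j)`), `injOn_stickBreaking_sun`, **`image_stickBreaking_sun`** (`φ(B) = Δ°`),
  **`map_stickBreaking_sun`** (`φ_* (D · Leb|_B) = Leb|_{Δ°}`),
  **`hasJacobian_simplex_of_boxFlow_sun`** (box flows `χ` with `HasJacobian (Leb|_B) χ Jχ` become simplex
  flows with Jacobian `D(χa) · Jχ(a) / D(a)` read through `φ`).
-/

noncomputable section

namespace Summit.Ventures.LatticeQCDFlow.Exactness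

open MeasureTheory Set Real Finset
open scoped ENNReal

variable {n : ℕ} {φ : (Fin n → ℝ) → (Fin n → ℝ)}
  (hφ : ∀ a i, φ a i = a i * ∏ j ∈ Finset.Iio i, (1 - a j))

include hφ

/-! ## The derivative and its determinant -/

/-- **The derivative of the stick-breaking chart.** -/
theorem hasFDerivAt_stickBreaking_sun (a : Fin n → ℝ) :
    HasFDerivAt φ (ContinuousLinearMap.pi fun i : Fin n =>
      a i • (∑ j ∈ Finset.Iio i, (∏ j' ∈ (Finset.Iio i).erase j, (1 - a j')) •
          (-(ContinuousLinearMap.proj (R := ℝ) (φ := fun _ : Fin n => ℝ) j))) +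
        (∏ j ∈ Finset.Iio i, (1 - a j)) • ContinuousLinearMap.proj (R := ℝ) (φ := fun _ : Fin n => ℝ) i) a := by
  have hfun : φ = fun a i => a i * ∏ j ∈ Finset.Iio i, (1 - a j) := funext fun a => funext fun i => hφ a i
  rw [hfun, hasFDerivAt_pi']
  intro i
  rw [ContinuousLinearMap.proj_pi]
  have h1 : HasFDerivAt (fun a : Fin n → ℝ => a i) (ContinuousLinearMap.proj (R := ℝ) (φ := fun _ : Fin n => ℝ) i) a :=
    hasFDerivAt_apply i a
  have h2 : HasFDerivAt (fun a : Fin n → ℝ => ∏ j ∈ Finset.Iio i, (1 - a j))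
      (∑ j ∈ Finset.Iio i, (∏ j' ∈ (Finset.Iio i).erase j, (1 - a j')) •
        (-(ContinuousLinearMap.proj (R := ℝ) (φ := fun _ : Fin n => ℝ) j))) a := by
    have h := HasFDerivAt.finsetProd (u := Finset.Iio i) (g := fun j (a : Fin n → ℝ) => 1 - a j)
      (g' := fun j => -(ContinuousLinearMap.proj (R := ℝ) (φ := fun _ : Fin n => ℝ) j)) (x := a)
      (fun j _ =>
        (show HasFDerivAt (fun a : Fin n → ℝ => a j) (ContinuousLinearMap.proj (R := ℝ) (φ := fun _ : Fin n => ℝ) j) a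
          from hasFDerivAt_apply j a).const_sub 1)
    exact h
  exact h1.mul h2

omit hφ in
/-- **`det dφ(a) = ∏_i ∏_{j<i} (1 − a_j)`**: the derivative is lower triangular. -/
theorem det_stickBreakingDeriv_sun (a : Fin n → ℝ) :
    (ContinuousLinearMap.pi fun i : Fin n =>
      a i • (∑ j ∈ Finset.Iio i, (∏ j' ∈ (Finset.Iio i).erase j, (1 - a j')) •
          (-(ContinuousLinearMap.proj (R := ℝ) (φ := fun _ : Fin n => ℝ) j))) +
        (∏ j ∈ Finset.Iio i, (1 - a j)) • ContinuousLinearMap.proj (R := ℝ) (φ := fun _ : Fin n => ℝ) i).det =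
      ∏ i : Fin n, ∏ j ∈ Finset.Iio i, (1 - a j) := by
  rw [ContinuousLinearMap.det, ← LinearMap.det_toMatrix']
  -- the matrix entries
  have hentry : ∀ i j : Fin n, LinearMap.toMatrix' ((ContinuousLinearMap.pi fun i : Fin n =>
      a i • (∑ j ∈ Finset.Iio i, (∏ j' ∈ (Finset.Iio i).erase j, (1 - a j')) •
          (-(ContinuousLinearMap.proj (R := ℝ) (φ := fun _ : Fin n => ℝ) j))) +
        (∏ j ∈ Finset.Iio i, (1 - a j)) • ContinuousLinearMap.proj (R := ℝ) (φ := fun _ : Fin n => ℝ) i :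
      (Fin n → ℝ) →L[ℝ] (Fin n → ℝ)) : (Fin n → ℝ) →ₗ[ℝ] (Fin n → ℝ)) i j =
      a i * (∑ j'' ∈ Finset.Iio i, (∏ j' ∈ (Finset.Iio i).erase j'', (1 - a j')) * (-(Pi.single j (1 : ℝ) : Fin n → ℝ) j'')) +
        (∏ j' ∈ Finset.Iio i, (1 - a j')) * (Pi.single j (1 : ℝ) : Fin n → ℝ) i := by
    intro i j
    rw [LinearMap.toMatrix'_apply]
    simp only [ContinuousLinearMap.coe_coe, ContinuousLinearMap.pi_apply, _root_.add_apply,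
      _root_.smul_apply, _root_.sum_apply, _root_.neg_apply, ContinuousLinearMap.proj_apply, smul_eq_mul]
  have htri : Matrix.BlockTriangular (LinearMap.toMatrix' ((ContinuousLinearMap.pi fun i : Fin n =>
      a i • (∑ j ∈ Finset.Iio i, (∏ j' ∈ (Finset.Iio i).erase j, (1 - a j')) •
          (-(ContinuousLinearMap.proj (R := ℝ) (φ := fun _ : Fin n => ℝ) j))) +
        (∏ j ∈ Finset.Iio i, (1 - a j)) • ContinuousLinearMap.proj (R := ℝ) (φ := fun _ : Fin n => ℝ) i :
      (Fin n → ℝ) →L[ℝ] (Fin n → ℝ)) : (Fin n → ℝ) →ₗ[ℝ] (Fin n → ℝ))) OrderDual.toDual := by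
    intro i j hij
    have hij' : i < j := hij
    rw [hentry]
    have h0 : (Pi.single j (1 : ℝ) : Fin n → ℝ) i = 0 := Pi.single_eq_of_ne hij'.ne 1
    have hsum : ∑ j'' ∈ Finset.Iio i, (∏ j' ∈ (Finset.Iio i).erase j'', (1 - a j')) *
        (-(Pi.single j (1 : ℝ) : Fin n → ℝ) j'') = 0 := by
      refine Finset.sum_eq_zero fun j'' hj'' => ?_
      have hne : j'' ≠ j := ((Finset.mem_Iio.mp hj'').trans hij').ne
      rw [Pi.single_eq_of_ne hne, neg_zero, mul_zero]
    rw [h0, hsum, mul_zero, mul_zero, add_zero]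
  rw [Matrix.det_of_lowerTriangular _ htri]
  refine Finset.prod_congr rfl fun i _ => ?_
  rw [hentry]
  have hsum : ∑ j'' ∈ Finset.Iio i, (∏ j' ∈ (Finset.Iio i).erase j'', (1 - a j')) *
      (-(Pi.single i (1 : ℝ) : Fin n → ℝ) j'') = 0 := by
    refine Finset.sum_eq_zero fun j'' hj'' => ?_
    have hne : j'' ≠ i := (Finset.mem_Iio.mp hj'').ne
    rw [Pi.single_eq_of_ne hne, neg_zero, mul_zero]
  rw [hsum, Pi.single_eq_same, mul_zero, zero_add, mul_one]

/-! ## Prefix sums: `Σ_{j<i} φ(a)_j = 1 − ∏_{j<i} (1 − a_j)` -/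

/-- Prefix identity along `ℕ`-prefixes: `Σ_{j<m} φ(a)_j = 1 − ∏_{j<m} (1 − a_j)`. -/
theorem sum_prefix_stickBreaking (a : Fin n → ℝ) (m : ℕ) :
    ∑ j ∈ Finset.univ.filter (fun j : Fin n => (j : ℕ) < m), φ a j =
      1 - ∏ j ∈ Finset.univ.filter (fun j : Fin n => (j : ℕ) < m), (1 - a j) := by
  induction m with
  | zero => simp
  | succ m ih =>
    by_cases hm : m < n
    · have hfilter : Finset.univ.filter (fun j : Fin n => (j : ℕ) < m + 1) =
          insert (⟨m, hm⟩ : Fin n) (Finset.univ.filter (fun j : Fin n => (j : ℕ) < m)) := by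
        ext j
        simp only [Finset.mem_filter, Finset.mem_univ, true_and, Finset.mem_insert, Fin.ext_iff]
        omega
      have hnot : (⟨m, hm⟩ : Fin n) ∉ Finset.univ.filter (fun j : Fin n => (j : ℕ) < m) := by simp
      have hIio : Finset.Iio (⟨m, hm⟩ : Fin n) = Finset.univ.filter (fun j : Fin n => (j : ℕ) < m) := by
        ext j
        simp only [Finset.mem_Iio, Finset.mem_filter, Finset.mem_univ, true_and, Fin.lt_def]
      rw [hfilter, Finset.sum_insert hnot, Finset.prod_insert hnot, ih, hφ, hIio]
      ring
    · have hfilter : Finset.univ.filter (fun j : Fin n => (j : ℕ) < m + 1) =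
          Finset.univ.filter (fun j : Fin n => (j : ℕ) < m) := by
        ext j
        simp only [Finset.mem_filter, Finset.mem_univ, true_and]
        omega
      rw [hfilter, ih]

/-- `Σ_{j<i} φ(a)_j = 1 − ∏_{j<i} (1 − a_j)` for `i : Fin n`. -/
theorem sum_Iio_stickBreaking (a : Fin n → ℝ) (i : Fin n) :
    ∑ j ∈ Finset.Iio i, φ a j = 1 - ∏ j ∈ Finset.Iio i, (1 - a j) := by
  have hIio : Finset.Iio i = Finset.univ.filter (fun j : Fin n => (j : ℕ) < i) := by
    ext j
    simp only [Finset.mem_Iio, Finset.mem_filter, Finset.mem_univ, true_and, Fin.lt_def]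
  rw [hIio, sum_prefix_stickBreaking hφ]

/-- `Σ_j φ(a)_j = 1 − ∏_j (1 − a_j)`. -/
theorem sum_univ_stickBreaking (a : Fin n → ℝ) : ∑ j, φ a j = 1 - ∏ j, (1 - a j) := by
  have huniv : (Finset.univ : Finset (Fin n)) = Finset.univ.filter (fun j : Fin n => (j : ℕ) < n) := by
    ext j
    simp
  rw [huniv, sum_prefix_stickBreaking hφ]

/-! ## Injectivity, image -/

/-- **The stick-breaking chart is injective on the open box.** -/
theorem injOn_stickBreaking_sun : InjOn φ (Set.pi univ fun _ : Fin n => Ioo (0 : ℝ) 1) := by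
  intro a ha b hb hab
  -- strong induction on the index
  have key : ∀ m : ℕ, ∀ i : Fin n, (i : ℕ) < m → a i = b i := by
    intro m
    induction m with
    | zero => intro i hi; omega
    | succ m ih =>
      intro i hi
      have hprod : ∏ j ∈ Finset.Iio i, (1 - a j) = ∏ j ∈ Finset.Iio i, (1 - b j) :=
        Finset.prod_congr rfl fun j hj => by rw [ih j (by have := Finset.mem_Iio.mp hj; rw [Fin.lt_def] at this; omega)]
      have hpos : 0 < ∏ j ∈ Finset.Iio i, (1 - b j) :=
        Finset.prod_pos fun j _ => by have := (Set.mem_univ_pi.mp hb) j; linarith [this.2]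
      have h := congr_fun hab i
      rw [hφ, hφ, hprod] at h
      exact mul_right_cancel₀ hpos.ne' h
  funext i
  exact key (i + 1) i (Nat.lt_succ_self _)

/-- **The image of the open box is the open simplex.** -/
theorem image_stickBreaking_sun :
    φ '' (Set.pi univ fun _ : Fin n => Ioo (0 : ℝ) 1) = {ρ : Fin n → ℝ | (∀ k, 0 < ρ k) ∧ ∑ k, ρ k < 1} := by
  ext ρ
  constructor
  · rintro ⟨a, ha, rfl⟩
    have ha' : ∀ j, 0 < a j ∧ a j < 1 := fun j => (Set.mem_univ_pi.mp ha) j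
    refine ⟨fun k => ?_, ?_⟩
    · rw [hφ]
      exact mul_pos (ha' k).1 (Finset.prod_pos fun j _ => by linarith [(ha' j).2])
    · rw [sum_univ_stickBreaking hφ]
      have hpos : 0 < ∏ j, (1 - a j) := Finset.prod_pos fun j _ => by linarith [(ha' j).2]
      linarith
  · rintro ⟨hpos, hsum⟩
    -- the inverse chart `a_i = ρ_i / (1 − Σ_{j<i} ρ_j)`
    set a : Fin n → ℝ := fun i => ρ i / (1 - ∑ j ∈ Finset.Iio i, ρ j) with ha
    have hpartial : ∀ i : Fin n, ∑ j ∈ Finset.Iio i, ρ j + ρ i ≤ ∑ j, ρ j := by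
      intro i
      have h : ∑ j ∈ Finset.Iio i, ρ j + ρ i = ∑ j ∈ insert i (Finset.Iio i), ρ j := by
        rw [Finset.sum_insert (by simp), add_comm]
      rw [h]
      exact Finset.sum_le_sum_of_subset_of_nonneg (Finset.subset_univ _) fun j _ _ => (hpos j).le
    have hden : ∀ i : Fin n, 0 < 1 - ∑ j ∈ Finset.Iio i, ρ j := fun i => by linarith [hpartial i, hpos i]
    have haB : a ∈ Set.pi univ fun _ : Fin n => Ioo (0 : ℝ) 1 := by
      refine Set.mem_univ_pi.mpr fun i => ⟨div_pos (hpos i) (hden i), ?_⟩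
      rw [ha, div_lt_one (hden i)]
      linarith [hpartial i]
    -- `∏_{j<m} (1 − a_j) = 1 − Σ_{j<m} ρ_j`
    have hprefix : ∀ m : ℕ, ∏ j ∈ Finset.univ.filter (fun j : Fin n => (j : ℕ) < m), (1 - a j) =
        1 - ∑ j ∈ Finset.univ.filter (fun j : Fin n => (j : ℕ) < m), ρ j := by
      intro m
      induction m with
      | zero => simp
      | succ m ih =>
        by_cases hm : m < n
        · have hfilter : Finset.univ.filter (fun j : Fin n => (j : ℕ) < m + 1) =
              insert (⟨m, hm⟩ : Fin n) (Finset.univ.filter (fun j : Fin n => (j : ℕ) < m)) := by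
            ext j
            simp only [Finset.mem_filter, Finset.mem_univ, true_and, Finset.mem_insert, Fin.ext_iff]
            omega
          have hnot : (⟨m, hm⟩ : Fin n) ∉ Finset.univ.filter (fun j : Fin n => (j : ℕ) < m) := by simp
          have hIio : Finset.Iio (⟨m, hm⟩ : Fin n) = Finset.univ.filter (fun j : Fin n => (j : ℕ) < m) := by
            ext j
            simp only [Finset.mem_Iio, Finset.mem_filter, Finset.mem_univ, true_and, Fin.lt_def]
          have hd := hden ⟨m, hm⟩
          rw [hIio] at hd
          rw [hfilter, Finset.prod_insert hnot, Finset.sum_insert hnot, ih, ha]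
          simp only [hIio]
          field_simp
          ring
        · have hfilter : Finset.univ.filter (fun j : Fin n => (j : ℕ) < m + 1) =
              Finset.univ.filter (fun j : Fin n => (j : ℕ) < m) := by
            ext j
            simp only [Finset.mem_filter, Finset.mem_univ, true_and]
            omega
          rw [hfilter, ih]
    refine ⟨a, haB, funext fun i => ?_⟩
    have hIio : Finset.Iio i = Finset.univ.filter (fun j : Fin n => (j : ℕ) < i) := by
      ext j
      simp only [Finset.mem_Iio, Finset.mem_filter, Finset.mem_univ, true_and, Fin.lt_def]
    rw [hφ, hIio, hprefix, ← hIio, ha]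
    have hd : (1 - ∑ j ∈ Finset.Iio i, ρ j) ≠ 0 := (hden i).ne'
    field_simp

omit hφ in
/-- The open box is measurable. -/
theorem measurableSet_openBox_sun : MeasurableSet (Set.pi univ fun _ : Fin n => Ioo (0 : ℝ) 1) :=
  MeasurableSet.univ_pi fun _ => measurableSet_Ioo

/-! ## The change of variables -/

/-- **The stick-breaking chart presents Lebesgue measure on the open simplex**:
`φ_* (D · Leb|_B) = Leb|_{Δ°}`, `D(a) = ∏_i ∏_{j<i} (1 − a_j) = |det dφ(a)|` on `B`. -/
theorem map_stickBreaking_sun :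
    Measure.map φ (((volume : Measure (Fin n → ℝ)).restrict (Set.pi univ fun _ : Fin n => Ioo (0 : ℝ) 1)).withDensity
        fun a => ENNReal.ofReal |∏ i : Fin n, ∏ j ∈ Finset.Iio i, (1 - a j)|) =
      (volume : Measure (Fin n → ℝ)).restrict {ρ : Fin n → ℝ | (∀ k, 0 < ρ k) ∧ ∑ k, ρ k < 1} := by
  have h := map_withDensity_abs_det_fderiv_eq_addHaar (volume : Measure (Fin n → ℝ))
    (measurableSet_openBox_sun (n := n)).nullMeasurableSet
    (fun a _ => (hasFDerivAt_stickBreaking_sun hφ a).hasFDerivWithinAt) (injOn_stickBreaking_sun hφ)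
  simp_rw [det_stickBreakingDeriv_sun] at h
  rw [image_stickBreaking_sun hφ] at h
  exact h

/-- **Box flows become simplex flows with the booked chart correction, every `N`.**  Let `χ` have
`HasJacobian (Leb|_B) χ Jχ` on the open box, let `G` (measurable) satisfy `G (φ a) = φ (χ a)` for a.e.
`a ∈ B`, and let `J_G` (measurable) satisfy `J_G (φ a) = D(χ a) · Jχ a / D(a)` for a.e. `a ∈ B`,
`D(a) = |∏_i ∏_{j<i} (1 − a_j)|`.  Then `HasJacobian (Leb|_{Δ°}) G J_G` — the engine's
`ld_chi + ld_phi_out − ld_phi_in` is an exact log-Jacobian on the cell. -/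
theorem hasJacobian_simplex_of_boxFlow_sun {χ : (Fin n → ℝ) → (Fin n → ℝ)} {Jχ : (Fin n → ℝ) → ℝ≥0∞}
    (hχ : HasJacobian ((volume : Measure (Fin n → ℝ)).restrict (Set.pi univ fun _ : Fin n => Ioo (0 : ℝ) 1)) χ Jχ)
    {G : (Fin n → ℝ) → (Fin n → ℝ)} (hG : Measurable G) {JG : (Fin n → ℝ) → ℝ≥0∞} (hJG : Measurable JG)
    (hcomm : ∀ᵐ a ∂((volume : Measure (Fin n → ℝ)).restrict (Set.pi univ fun _ : Fin n => Ioo (0 : ℝ) 1)),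
      G (φ a) = φ (χ a))
    (hJ : ∀ᵐ a ∂((volume : Measure (Fin n → ℝ)).restrict (Set.pi univ fun _ : Fin n => Ioo (0 : ℝ) 1)),
      JG (φ a) = ENNReal.ofReal |∏ i : Fin n, ∏ j ∈ Finset.Iio i, (1 - (χ a) j)| * Jχ a /
        ENNReal.ofReal |∏ i : Fin n, ∏ j ∈ Finset.Iio i, (1 - a j)|) :
    HasJacobian ((volume : Measure (Fin n → ℝ)).restrict {ρ : Fin n → ℝ | (∀ k, 0 < ρ k) ∧ ∑ k, ρ k < 1}) G JG := by
  have hDm : Measurable fun a : Fin n → ℝ => ENNReal.ofReal |∏ i : Fin n, ∏ j ∈ Finset.Iio i, (1 - a j)| :=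
    ENNReal.measurable_ofReal.comp ((continuous_finsetProd _ fun i _ => continuous_finsetProd _ fun j _ =>
      continuous_const.sub (continuous_apply j)).measurable.abs)
  have hD0 : ∀ᵐ a ∂((volume : Measure (Fin n → ℝ)).restrict (Set.pi univ fun _ : Fin n => Ioo (0 : ℝ) 1)),
      ENNReal.ofReal |∏ i : Fin n, ∏ j ∈ Finset.Iio i, (1 - a j)| ≠ 0 := by
    refine (ae_restrict_iff' measurableSet_openBox_sun).mpr (Filter.Eventually.of_forall fun a ha => ?_)
    rw [ENNReal.ofReal_ne_zero_iff]
    exact abs_pos.mpr (Finset.prod_ne_zero_iff.mpr fun i _ => Finset.prod_ne_zero_iff.mpr fun j _ => by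
      have := (Set.mem_univ_pi.mp ha) j; linarith [this.2])
  have hDtop : ∀ᵐ a ∂((volume : Measure (Fin n → ℝ)).restrict (Set.pi univ fun _ : Fin n => Ioo (0 : ℝ) 1)),
      ENNReal.ofReal |∏ i : Fin n, ∏ j ∈ Finset.Iio i, (1 - a j)| ≠ ∞ :=
    Filter.Eventually.of_forall fun a => ENNReal.ofReal_ne_top
  have hχ' := hχ.withDensity_of_pos_ae hDm hD0 hDtop
  have hφm : Measurable φ := by
    rw [show φ = fun a i => a i * ∏ j ∈ Finset.Iio i, (1 - a j) from funext fun a => funext fun i => hφ a i]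
    exact measurable_pi_lambda _ fun i => (measurable_pi_apply i).mul
      (Finset.measurable_prod _ fun j _ => measurable_const.sub (measurable_pi_apply j))
  refine hasJacobian_of_presentation_ae hφm (map_stickBreaking_sun hφ) hχ' hG hJG ?_ ?_
  · exact (withDensity_absolutelyContinuous _ _) hcomm
  · exact (withDensity_absolutelyContinuous _ _) hJ

end Summit.Ventures.LatticeQCDFlow.Exactness
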